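import Mathlib
import HarnessLib
import Summits.Ventures.LatticeQCDFlow.Scoring.MarkovChainCLTBatchMeans
import Summits.Ventures.LatticeQCDFlow.Scoring.MarkovChainCLTCoverage
import Summits.Ventures.LatticeQCDFlow.Exactness.CPNMetropolisSweepErgodic

/-!
# The `cpn_2d` Metropolis sweep: a one-step minorisation by the uniform product law, the CLT for its
# time averages, and consistent coin-free batch-means error bars — from every initial configuration law

HONEST FRAMING: exact (Metropolis-corrected) sampling algorithms for lattice gauge theory;
figures of merit are autocorrelation/cost numbers at stated couplings and volumes; no
continuum-physics claim.

Venture `LatticeQCDFlow` (cell pub-lqcd), topic `Scoring`; FANOUT row 8 (`s0-cpn-nemc` — the 2D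
CP(N−1) sampler seat — GEN-19).  NEW WORK of the cell, not a published result; no definition is
introduced.  Row 9 (`eng-latcore`) typed the engine's `cpn_2d` Metropolis sweep
(`Exactness/CPNMetropolisSweepErgodic.lean`: `cpnMetropolisSweep`, exact for the lattice CP(N−1) law
`cpnGibbsLaw` and uniformly ergodic, via the generic Metropolis-within-Gibbs file
`Exactness/SiteMetropolisScan.lean`).  This file extracts from the same ingredients the ONE-STEP
WHOLE-SPACE MINORISATION in the shape used by row 8's chain-level theorems — `κ(ω, ·) ≥ ε ⊗(uniform)`
with an explicit `ε ∈ (0, 1)` (half the product of the one-kick Doeblin constants, to make it `< 1`) —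
and feeds it to `Scoring/MarkovChainCLT.lean`, `Scoring/BatchMeansConsistency.lean` and
`Scoring/MarkovChainCLTBatchMeans.lean`: for every bounded measurable observable of the CP(N−1)
configuration and EVERY initial law, the time averages of the `cpn_2d` Metropolis run satisfy the
CLT with the Green–Kubo variance `σ²_f`, the batch-means estimator `a_n b_n · SE²_BM` of `σ²_f`
computed from the run is consistent, and (for `σ²_f > 0`) the interval `f̄_N ± z σ̂_BM/√N` has
asymptotically exact coverage.  Value-free: no rate or constant is claimed to be useful; idealised
arithmetic.  Nothing is cited.

## Content (`εs, εl > 0`; `l` a list visiting every site and link; `K = cpnMetropolisSweep … εs εl l`,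
## `π = cpnGibbsLaw …`)

* `isProbabilityMeasure_cpnGibbsLaw`; **`cpn_metropolisSweep_minorised`** — `π` is `K`-invariant and
  `∃ ε, 0 < ε < 1 ∧ ∀ ω A, ε · (Measure.pi cpnRef) A ≤ K ω A`;
* **`cpn_metropolisSweep_timeAverage_clt`** — `(√n)⁻¹ Σ_{t<n} (f(X_t) − π f) ⇒ N(0, σ²_f)`, any start;
* **`cpn_metropolisSweep_batchMeans_tendstoInMeasure`** — `a_n b_n · SE²_BM → σ²_f` in probability;
* **`cpn_metropolisSweep_batchMeans_coverage`** — `σ²_f > 0`, `z > 0`: coverage `→ (gaussianReal 0 1)[−z, z]`;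
* `isMarkovKernel_cpnMetropolisSweep` — the instance the three statements take as `[IsMarkovKernel K]`
  (supply it with `haveI := isMarkovKernel_cpnMetropolisSweep …`).
-/

noncomputable section

namespace Summit.Ventures.LatticeQCDFlow.Scoring

open MeasureTheory ProbabilityTheory Filter Finset Summit.Ventures.LatticeQCDFlow.Exactness
open Literature.Probability.MarkovChains
open scoped ENNReal Topology

section CPN

variable {V E : Type*} [Fintype V] [Fintype E] [DecidableEq V] [DecidableEq E] {d : ℕ}
  (src tgt : E → V) (J : EuclideanSpace ℝ (Fin (d + 2)) →L[ℝ] EuclideanSpace ℝ (Fin (d + 2)))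
  (c : E → ℝ)

omit [DecidableEq V] [DecidableEq E] in
/-- The lattice CP(N−1) law is a probability measure. -/
theorem isProbabilityMeasure_cpnGibbsLaw : IsProbabilityMeasure (cpnGibbsLaw src tgt J c (V := V) (E := E) (d := d)) := by
  have hS := continuous_cpnAction src tgt J c (V := V) (E := E) (d := d)
  haveI : ∀ i, Nonempty (CPNVar V E d i) := fun i => nonempty_of_isProbabilityMeasure (cpnRef V E d i)
  haveI : Nonempty (CPNConfig V E d) := inferInstance
  obtain ⟨ωa, -, hmin⟩ := isCompact_univ.exists_isMinOn Set.univ_nonempty hS.continuousOn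
  obtain ⟨ωb, -, hmax⟩ := isCompact_univ.exists_isMaxOn Set.univ_nonempty hS.continuousOn
  have hωa : ∀ ω, cpnAction src tgt J c ωa ≤ cpnAction src tgt J c ω := fun ω => (isMinOn_iff.1 hmin) ω (Set.mem_univ ω)
  have hωb : ∀ ω, cpnAction src tgt J c ω ≤ cpnAction src tgt J c ωb := fun ω => (isMaxOn_iff.1 hmax) ω (Set.mem_univ ω)
  exact isProbabilityMeasure_piGibbsLaw (μ := cpnRef V E d) (p := gibbsDensity (cpnAction src tgt J c))
    (m := ENNReal.ofReal (Real.exp (-cpnAction src tgt J c ωb)))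
    (M := ENNReal.ofReal (Real.exp (-cpnAction src tgt J c ωa)))
    (by rw [Ne, ENNReal.ofReal_eq_zero, not_le]; exact Real.exp_pos _) ENNReal.ofReal_ne_top
    (fun ω => ENNReal.ofReal_le_ofReal (Real.exp_le_exp.2 (neg_le_neg (hωb ω))))
    (fun ω => ENNReal.ofReal_le_ofReal (Real.exp_le_exp.2 (neg_le_neg (hωa ω))))

/-- **THE `cpn_2d` METROPOLIS SWEEP IS MINORISED BY THE UNIFORM PRODUCT LAW, IN ONE STEP**
(`εs, εl > 0`, the list visits every variable): `cpnGibbsLaw` is invariant and there is `ε ∈ (0, 1)`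
with `ε · ⊗(uniform)(A) ≤ K(ω, A)` for every configuration `ω` and measurable `A`. -/
theorem cpn_metropolisSweep_minorised {εs εl : ℝ} (hεs : 0 < εs) (hεl : 0 < εl) {l : List (V ⊕ E)}
    (hl : ∀ i, i ∈ l) :
    Kernel.Invariant (cpnMetropolisSweep src tgt J c εs εl l) (cpnGibbsLaw src tgt J c) ∧
    ∃ ε : ℝ≥0∞, 0 < ε ∧ ε < 1 ∧ ∀ (ω : CPNConfig V E d) {A : Set (CPNConfig V E d)}, MeasurableSet A →
      ε * Measure.pi (cpnRef V E d) A ≤ cpnMetropolisSweep src tgt J c εs εl l ω A := by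
  have hS := continuous_cpnAction src tgt J c (V := V) (E := E) (d := d)
  have hw := measurable_cpnWeight src tgt J c (V := V) (E := E) (d := d)
  haveI : ∀ i, Nonempty (CPNVar V E d i) := fun i => nonempty_of_isProbabilityMeasure (cpnRef V E d i)
  haveI : Nonempty (CPNConfig V E d) := inferInstance
  refine ⟨metropolisScan_invariant_piGibbsLaw (μ := cpnRef V E d) (P := cpnMetroProposal V E d εs εl) hw
    (fun _ => Real.exp_pos _) (cpnMetroProposal_symm hεs.ne' εl) l, ?_⟩
  obtain ⟨ωa, -, hmin⟩ := isCompact_univ.exists_isMinOn Set.univ_nonempty hS.continuousOn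
  obtain ⟨ωb, -, hmax⟩ := isCompact_univ.exists_isMaxOn Set.univ_nonempty hS.continuousOn
  have hωa : ∀ ω, cpnAction src tgt J c ωa ≤ cpnAction src tgt J c ω := fun ω => (isMinOn_iff.1 hmin) ω (Set.mem_univ ω)
  have hωb : ∀ ω, cpnAction src tgt J c ω ≤ cpnAction src tgt J c ωb := fun ω => (isMaxOn_iff.1 hmax) ω (Set.mem_univ ω)
  set m : ℝ := Real.exp (-cpnAction src tgt J c ωb) with hm
  set M : ℝ := Real.exp (-cpnAction src tgt J c ωa) with hM
  have hm0 : 0 < m := Real.exp_pos _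
  have hwm : ∀ ω, m ≤ cpnWeight src tgt J c ω := fun ω => Real.exp_le_exp.2 (neg_le_neg (hωb ω))
  have hwM : ∀ ω, cpnWeight src tgt J c ω ≤ M := fun ω => Real.exp_le_exp.2 (neg_le_neg (hωa ω))
  have hdoeb := metropolisScan_minorised (μ := cpnRef V E d) (P := cpnMetroProposal V E d εs εl) hw hm0 hwm hwM
    (smul_cpnRef_le_cpnMetroProposal hεs hεl) hl
  set δE : ℝ≥0∞ := (cpnMetroConst d εs εl * ENNReal.ofReal (m / M)) ^ l.length with hδE
  have hδ1 : δE ≤ 1 := by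
    have h := Measure.le_iff'.1 (hdoeb ωa) Set.univ
    haveI := isMarkovKernel_metropolisScan (P := cpnMetroProposal V E d εs εl) hw l
    rw [Measure.smul_apply, smul_eq_mul, measure_univ, mul_one] at h
    exact h.trans prob_le_one
  have hδ0 : δE ≠ 0 := pow_ne_zero _ (mul_ne_zero (cpnMetroConst_ne_zero hεs.ne' hεl)
    (by rw [Ne, ENNReal.ofReal_eq_zero, not_le]; exact div_pos hm0 (Real.exp_pos _)))
  have hδtop : δE ≠ ⊤ := ne_top_of_le_ne_top ENNReal.one_ne_top hδ1
  refine ⟨δE / 2, ENNReal.div_pos hδ0 (by norm_num), ?_, fun ω A _ => ?_⟩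
  · exact lt_of_lt_of_le (ENNReal.half_lt_self hδ0 hδtop) hδ1
  · have h := Measure.le_iff'.1 (hdoeb ω) A
    rw [Measure.smul_apply, smul_eq_mul] at h
    exact (mul_le_mul' ENNReal.half_le_self le_rfl).trans h

/-- **THE CLT FOR TIME AVERAGES OF THE `cpn_2d` METROPOLIS SWEEP**, from every initial law: for
`|f| ≤ C` measurable on configurations and `Y ~ N(0, σ²_f)` (Green–Kubo variance under `cpnGibbsLaw`),
`(√n)⁻¹ Σ_{t<n} (f(X_t) − π f) ⇒ Y`. -/
theorem cpn_metropolisSweep_timeAverage_clt {εs εl : ℝ} (hεs : 0 < εs) (hεl : 0 < εl)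
    {l : List (V ⊕ E)} (hl : ∀ i, i ∈ l) {f : CPNConfig V E d → ℝ} (hf : Measurable f) {C : ℝ}
    (hC : ∀ ω, |f ω| ≤ C) (μ₀ : Measure (CPNConfig V E d)) [IsProbabilityMeasure μ₀]
    {Ω' : Type*} [MeasurableSpace Ω'] {P' : Measure Ω'} [IsProbabilityMeasure P'] {Y : Ω' → ℝ}
    (hY : HasLaw Y (gaussianReal 0 (Real.toNNReal
      ((∫ y, (f y - ∫ z, f z ∂(cpnGibbsLaw src tgt J c)) ^ 2 ∂(cpnGibbsLaw src tgt J c))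
        + 2 * ∑' k, ∫ y, (f y - ∫ z, f z ∂(cpnGibbsLaw src tgt J c))
          * (kop (cpnMetropolisSweep src tgt J c εs εl l))^[k + 1]
            (fun y => f y - ∫ z, f z ∂(cpnGibbsLaw src tgt J c)) y ∂(cpnGibbsLaw src tgt J c)))) P')
    [hK : IsMarkovKernel (cpnMetropolisSweep src tgt J c εs εl l)]
    [IsProbabilityMeasure (Kernel.trajMeasure (X := fun _ : ℕ => CPNConfig V E d) μ₀
        (fun n : ℕ => (cpnMetropolisSweep src tgt J c εs εl l).comap
          (fun h : (i : ↥(Finset.Iic n)) → CPNConfig V E d => h ⟨n, Finset.mem_Iic.2 le_rfl⟩)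
          (measurable_pi_apply _)))] :
    TendstoInDistribution (fun (n : ℕ) (x : ℕ → CPNConfig V E d) =>
        (Real.sqrt n)⁻¹ * ∑ t ∈ Finset.range n, (f (x t) - ∫ z, f z ∂(cpnGibbsLaw src tgt J c)))
      atTop Y (fun _ => (Kernel.trajMeasure (X := fun _ : ℕ => CPNConfig V E d) μ₀
        (fun n : ℕ => (cpnMetropolisSweep src tgt J c εs εl l).comap
          (fun h : (i : ↥(Finset.Iic n)) → CPNConfig V E d => h ⟨n, Finset.mem_Iic.2 le_rfl⟩)
          (measurable_pi_apply _)))) P' := by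
  haveI := isProbabilityMeasure_cpnGibbsLaw src tgt J c (V := V) (E := E) (d := d)
  obtain ⟨hinv, ε, hε0, hε1, hdoeb⟩ := cpn_metropolisSweep_minorised src tgt J c hεs hεl hl
  exact markovChain_clt (κ := cpnMetropolisSweep src tgt J c εs εl l) (ν := Measure.pi (cpnRef V E d)) hinv
    (fun ω _ hA => hdoeb ω hA) hε0 hε1 hf hC μ₀ hY

/-- **BATCH MEANS ESTIMATE `σ²_f` CONSISTENTLY ALONG THE `cpn_2d` METROPOLIS RUN**, from every
initial law: `a_n b_n · SE²_BM → σ²_f` in probability as `a_n, b_n → ∞`. -/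
theorem cpn_metropolisSweep_batchMeans_tendstoInMeasure {εs εl : ℝ} (hεs : 0 < εs) (hεl : 0 < εl)
    {l : List (V ⊕ E)} (hl : ∀ i, i ∈ l) {f : CPNConfig V E d → ℝ} (hf : Measurable f) {C : ℝ}
    (hC : ∀ ω, |f ω| ≤ C) (μ₀ : Measure (CPNConfig V E d)) [IsProbabilityMeasure μ₀]
    {a b : ℕ → ℕ} (ha : Tendsto a atTop atTop) (hb : Tendsto b atTop atTop)
    [hK : IsMarkovKernel (cpnMetropolisSweep src tgt J c εs εl l)] :
    TendstoInMeasure (Kernel.trajMeasure (X := fun _ : ℕ => CPNConfig V E d) μ₀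
        (fun n : ℕ => (cpnMetropolisSweep src tgt J c εs εl l).comap
          (fun h : (i : ↥(Finset.Iic n)) → CPNConfig V E d => h ⟨n, Finset.mem_Iic.2 le_rfl⟩)
          (measurable_pi_apply _)))
      (fun (n : ℕ) (x : ℕ → CPNConfig V E d) => ((b n * a n : ℕ) : ℝ)
        * replicaSEsq (fun j (x : ℕ → CPNConfig V E d) =>
            (∑ i ∈ Finset.range (b n), f (x (b n * j + i))) / (b n)) (a n) x)
      atTop (fun _ => (∫ y, (f y - ∫ z, f z ∂(cpnGibbsLaw src tgt J c)) ^ 2 ∂(cpnGibbsLaw src tgt J c))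
        + 2 * ∑' k, ∫ y, (f y - ∫ z, f z ∂(cpnGibbsLaw src tgt J c))
          * (kop (cpnMetropolisSweep src tgt J c εs εl l))^[k + 1]
            (fun y => f y - ∫ z, f z ∂(cpnGibbsLaw src tgt J c)) y ∂(cpnGibbsLaw src tgt J c)) := by
  haveI := isProbabilityMeasure_cpnGibbsLaw src tgt J c (V := V) (E := E) (d := d)
  obtain ⟨hinv, ε, hε0, hε1, hdoeb⟩ := cpn_metropolisSweep_minorised src tgt J c hεs hεl hl
  exact chain_batchMeans_sigmaHat_tendstoInMeasure (κ := cpnMetropolisSweep src tgt J c εs εl l)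
    (ν := Measure.pi (cpnRef V E d)) hinv (fun ω _ hA => hdoeb ω hA) hε0 hε1 hf hC μ₀ ha hb

/-- **THE COIN-FREE BATCH-MEANS INTERVAL OF A `cpn_2d` METROPOLIS RUN IS ASYMPTOTICALLY EXACT**
(`σ²_f > 0`, `a_n, b_n → ∞`, any initial law): for `z > 0` the probability of
`|(√N_n)⁻¹ Σ_{t<N_n} (f(X_t) − π f)| ≤ z σ̂_n` tends to `(gaussianReal 0 1)[−z, z]`, `N_n = b_n a_n`. -/
theorem cpn_metropolisSweep_batchMeans_coverage {εs εl : ℝ} (hεs : 0 < εs) (hεl : 0 < εl)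
    {l : List (V ⊕ E)} (hl : ∀ i, i ∈ l) {f : CPNConfig V E d → ℝ} (hf : Measurable f) {C : ℝ}
    (hC : ∀ ω, |f ω| ≤ C)
    (hσ : 0 < (∫ y, (f y - ∫ z, f z ∂(cpnGibbsLaw src tgt J c)) ^ 2 ∂(cpnGibbsLaw src tgt J c))
        + 2 * ∑' k, ∫ y, (f y - ∫ z, f z ∂(cpnGibbsLaw src tgt J c))
          * (kop (cpnMetropolisSweep src tgt J c εs εl l))^[k + 1]
            (fun y => f y - ∫ z, f z ∂(cpnGibbsLaw src tgt J c)) y ∂(cpnGibbsLaw src tgt J c))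
    (μ₀ : Measure (CPNConfig V E d)) [IsProbabilityMeasure μ₀]
    {a b : ℕ → ℕ} (ha : Tendsto a atTop atTop) (hb : Tendsto b atTop atTop) {z : ℝ} (hz : 0 < z)
    [hK : IsMarkovKernel (cpnMetropolisSweep src tgt J c εs εl l)] :
    Tendsto (fun n : ℕ => (Kernel.trajMeasure (X := fun _ : ℕ => CPNConfig V E d) μ₀
        (fun n : ℕ => (cpnMetropolisSweep src tgt J c εs εl l).comap
          (fun h : (i : ↥(Finset.Iic n)) → CPNConfig V E d => h ⟨n, Finset.mem_Iic.2 le_rfl⟩)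
          (measurable_pi_apply _))).real
      {x | |((Real.sqrt ((b n * a n : ℕ) : ℝ))⁻¹
          * ∑ t ∈ Finset.range (b n * a n), (f (x t) - ∫ z, f z ∂(cpnGibbsLaw src tgt J c)))
        / Real.sqrt (((b n * a n : ℕ) : ℝ)
          * replicaSEsq (fun j (x : ℕ → CPNConfig V E d) =>
              (∑ i ∈ Finset.range (b n), f (x (b n * j + i))) / (b n)) (a n) x)| ≤ z})
      atTop (𝓝 ((gaussianReal 0 1).real (Set.Icc (-z) z))) := by
  haveI := isProbabilityMeasure_cpnGibbsLaw src tgt J c (V := V) (E := E) (d := d)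
  obtain ⟨hinv, ε, hε0, hε1, hdoeb⟩ := cpn_metropolisSweep_minorised src tgt J c hεs hεl hl
  exact markovChain_batchMeans_studentized_coverage (κ := cpnMetropolisSweep src tgt J c εs εl l)
    (ν := Measure.pi (cpnRef V E d)) hinv (fun ω _ hA => hdoeb ω hA) hε0 hε1 hf hC hσ μ₀ ha hb hz

/-- The Markov-kernel instance used above: every `cpn_2d` Metropolis sweep is a Markov kernel. -/
theorem isMarkovKernel_cpnMetropolisSweep (εs εl : ℝ) (l : List (V ⊕ E)) :
    IsMarkovKernel (cpnMetropolisSweep src tgt J c εs εl l (d := d)) :=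
  isMarkovKernel_metropolisScan (P := cpnMetroProposal V E d εs εl) (measurable_cpnWeight src tgt J c) l

end CPN

end Summit.Ventures.LatticeQCDFlow.Scoring

end
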